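import Summits.ResolutionOfSingularities.ResolutionOfSingularities.Theorems.WildConesClassicalRegimesStubMuDropCharTwoOrdPDict
import Summits.ResolutionOfSingularities.ResolutionOfSingularities.Theorems.FrobeniusClosingClosingReductionFactorization

/-!
# [OURS · L1 W4.6, rungs (i)/(ii) — the FORMAL DICTIONARY] The point-blow-up dynamics of route
# `WildCones` IS the equation of the transform of the hypersurface `z^p = a(u₁,…,uₙ)` under the formal
# blow-up of the closed point — chart `u_i`, point `(τ, ζ)` of the exceptional divisor — followed by
# the cleaning change of the `z`-coordinate

Cell res-hironaka (LADDER-RESOLUTION rung L, D-0089), slot W4.6 «restricted regimes as rungs of the typed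
Th. 16.6 procedure», seat res-L1-s46-pv-2: «(i) SURFACES, second prover … Lipman normalised blow-up
dictionary as in `ClassicalRegimes` n = 2, or the embedded-surface-in-3-space variant». Host: route
`WildCones`, crux `ClassicalRegimes` (stmt-ResolutionOfSingularities-16884), `--supports … --as helper`.

HONEST FRAMING. Everything here is OURS (definitions and theorems about route `WildCones`' own typed
coefficient calculus, `Theorems/WildConesClassicalRegimesDefs.lean`); NOTHING here is a statement of
H. Hironaka's manuscript [Hironaka2017] and nothing of it is used; no FACT-LIST premise is used. AI review
is weaker than expert review.

## What this file settles, and what it does not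

The W4.6 rungs proved over the coefficient dynamics (`…CampaignW46Surfaces` rung (i),
`…CampaignW46ThreefoldsCharTwo` rung (ii) at `p = 2`, the crux `ClassicalRegimes` itself) are theorems
about a CALCULUS on coefficient functions: `step i τ` = clean, re-index (`bl`), shift (`dv`), binomially
translate (`tr`), clean. That this calculus is «blow up the closed point of the ambient space of
`z^p = a(u)`, pass to the chart `u_i`, move to a closed point of the exceptional divisor, rewrite the
equation» was so far a docstring. This file proves it as ONE RING IDENTITY in the coordinate ring
`κ⟦u₁,…,uₙ⟧[z]` of the hypersurface's formal ambient (DICTIONARY, FORMAL HALF): for a state `c` of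
multiplicity `p` (`MultP`) over a perfect field `κ` of characteristic `p`, with `a = ser c`,
`a′ = ser (step i τ c)`,

  `Ψ (z^p − a) = u_i^p · (z^p − a′)`,   `Ψ := blowupChart n κ i τ (cleaningShift p n κ c i τ)`,

where `Ψ` is the `κ`-algebra endomorphism `u_i ↦ u_i`, `u_j ↦ u_i (u_j + τ_j)` (`j ≠ i`),
`z ↦ u_i (z + r(u))` — the chart-`u_i` substitution of the blow-up of the origin of the `(z,u)`-space at
the closed point `(u_j/u_i = τ_j, z/u_i = r(0))` of the exceptional divisor `u_i = 0`, composed with the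
`κ⟦u⟧`-automorphism `z ↦ z + (r − r(0))` of the fibre coordinate (the CLEANING: `r = Σ_B (T_{pB})^{1/p} u^B`
is the `p`-th root of the `p`-th-power part of the total transform `T`, `σ_{i,τ}(a) = u_i^p T`; it needs
`p`-th roots of coefficients, whence `[PerfectField κ]` — the faithful geometric reading the crux's
docstrings announce). So `u_i^p` is the `p`-th power of the exceptional parameter and `z^p − a′` is the
equation of the controlled (= strict, the multiplicity being `p`) transform in the new formal coordinates:
the coefficient dynamics is EXACTLY the formal point-blow-up procedure on the hypersurface
`z^p = a(u)`, one chart point at a time.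

NOT settled here (the SCHEME HALF of the dictionary, recorded so that nobody mistakes this file for it):
(S1) for the typed Th. 16.6 procedure (`CampaignW46.Step`: a Mathlib blow-up `IsBlowup π 𝓘_D` of an
ambient datum along a closed point) the completed local ring of `Z′` at a closed point of `π⁻¹(ξ)` is
`κ(ξ′)⟦z,u⟧` with `π^♯` inducing `Ψ` (up to the choice of the chart index `i` and a finite separable
residue extension); (S2) `Isol`/`MultP` are the completions of «isolated singular point» / «multiplicity
`p`» of the algebraic hypersurface. With (S1)–(S2) and `CampaignW46.Run.centre_eq_sing`
(`Theorems/MarkedTransferCampaignW46ForcedRegime.lean`) the coefficient rungs become rungs about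
`CampaignW46.TerminatesNabla` in the forced regime; that composition is NOT claimed here.

## Declarations (namespace `…Theorems.CampaignW46.FormalDictionary`)

* `moveSer p n κ c i τ` — the total-transform series `T = Σ_A tr i τ p (dv i p (bl i (clean c))) A · u^A`;
* `pPowPart p n κ f` — the `p`-th-power part of a series (monomials `u^A` with `p ∣ A_j` for all `j`);
* `pthRoot p n κ f` — `Σ_B (f_{pB})^{1/p} u^B` (perfect `κ`), with `pthRoot_pow : (pthRoot f)^p = pPowPart f`;
* `cleaningShift p n κ c i τ := pthRoot (moveSer …)` — the series `r`;
* `blowupChart n κ i τ r` — the ring endomorphism `Ψ` of `κ⟦u⟧[z]`;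
* `subst_chartSubst_ser` (the crux's dictionary `σ(a) = u_i^p T`, = `NarrowRunsDie.stub_dict` via the
  landed `WildCones.MuDropCharTwoOrdP.X_pow_mul_serT_eq_subst`), `ser_step_add_pPowPart`
  (`a′ + pPowPart T = T`, via the landed `MuDropCharTwoOrdP.coeff_ser_step`), `blowupChart_C`,
  `blowupChart_X`, and the main identity `blowupChart_atom`.

References: route file `Theses/WildCones.lean` (cruxes `ClassicalRegimes`, `NarrowRunsDie` — «the
dictionary state ↦ local ring of the strict transform»); Mathlib `MvPowerSeries.map_frobenius_expand`
(Frobenius on power series); H. Hironaka, ms. 2017, Th. 16.6 p.84 — quoted for the ROLE of «the blowup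
`π : Z′ → Z` with center `D`» only, under adjudication, not cited as fact. [folklore]
-/

noncomputable section

-- single-problem summit: the doubled namespace component `ResolutionOfSingularities` is forced
set_option linter.dupNamespace false

open scoped BigOperators Classical
open MvPowerSeries

namespace Summit.ResolutionOfSingularities.ResolutionOfSingularities.Theorems

namespace CampaignW46.FormalDictionary

open WildCones
open Summit.ResolutionOfSingularities.ResolutionOfSingularities.Theorems.FrobeniusClosing (chartSubst chartMap)
open Summit.ResolutionOfSingularities.ResolutionOfSingularities.Theorems.FrobeniusClosing.FactorizationProof
  (hasSubst_chartSubst chartMap_X_self chartMap_X_of_ne)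

variable {n : ℕ} {κ : Type} [Field κ]

/-! ## The series of the move, the `p`-th-power part, `p`-th roots -/

/-- [OURS · L1 W4.6] The TOTAL-TRANSFORM SERIES of the move `(i, τ)` at the state `c`:
`T = Σ_A tr i τ p (dv i p (bl i (clean c))) A · u^A` — the series whose cleaning is the successor state
(`ser_step_add_pPowPart`) and which the chart substitution produces from `a = ser c` up to the factor
`u_i^p` (`subst_chartSubst_ser`). [folklore] -/
def moveSer (p n : ℕ) (κ : Type) [Field κ] (c : (Fin n → ℕ) → κ) (i : Fin n) (τ : Fin n → κ) :
    MvPowerSeries (Fin n) κ :=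
  show MvPowerSeries (Fin n) κ from
    fun A : Fin n →₀ ℕ => tr n κ i τ p (dv n κ i p (bl n κ i (clean p n κ c))) ⇑A

/-- [OURS · L1 W4.6] The `p`-TH-POWER PART of a series: keep exactly the monomials `u^A` all of whose
exponents are divisible by `p` (the part that cleaning deletes). [folklore] -/
def pPowPart (p n : ℕ) (κ : Type) [Field κ] (f : MvPowerSeries (Fin n) κ) : MvPowerSeries (Fin n) κ :=
  show MvPowerSeries (Fin n) κ from
    fun A : Fin n →₀ ℕ => if ∀ j, p ∣ A j then coeff A f else 0

/-- [OURS · L1 W4.6] The `p`-TH ROOT of the `p`-th-power part of a series over a perfect field of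
characteristic `p`: `Σ_B (f_{pB})^{1/p} u^B` (`frobeniusEquiv⁻¹` coefficient-wise). [folklore] -/
def pthRoot (p n : ℕ) [Fact p.Prime] (κ : Type) [Field κ] [CharP κ p] [PerfectField κ]
    (f : MvPowerSeries (Fin n) κ) : MvPowerSeries (Fin n) κ :=
  show MvPowerSeries (Fin n) κ from
    fun B : Fin n →₀ ℕ => (frobeniusEquiv κ p).symm (coeff (p • B) f)

/-- [OURS · L1 W4.6] The CLEANING SHIFT `r` of the move `(i, τ)` at `c`: the `p`-th root of the
`p`-th-power part of the total-transform series (`cleaningShift_pow`); the new fibre coordinate is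
`z ↦ z + r(u)`, and `r(0)` is the `z/u_i`-coordinate of the closed point of the exceptional divisor the
procedure moves to. [folklore] -/
def cleaningShift (p n : ℕ) [Fact p.Prime] (κ : Type) [Field κ] [CharP κ p] [PerfectField κ]
    (c : (Fin n → ℕ) → κ) (i : Fin n) (τ : Fin n → κ) : MvPowerSeries (Fin n) κ :=
  pthRoot p n κ (moveSer p n κ c i τ)

/-- [OURS · L1 W4.6] The BLOW-UP CHART MAP `Ψ` on the coordinate ring `κ⟦u₁,…,uₙ⟧[z]` of the formal
ambient of the hypersurface `z^p = a(u)`: `u_i ↦ u_i`, `u_j ↦ u_i (u_j + τ_j)` (`j ≠ i`; the chart-`u_i`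
substitution `σ_{i,τ}` of route `FrobeniusClosing`, `chartSubst`), `z ↦ u_i (z + r)` — blow up the origin,
chart `u_i`, move to the point `(τ, r(0))` of the exceptional divisor, re-normalise the fibre coordinate
by `r − r(0)`. A ring endomorphism (`Polynomial.eval₂RingHom`). [folklore] -/
def blowupChart (n : ℕ) (κ : Type) [Field κ] (i : Fin n) (τ : Fin n → κ) (r : MvPowerSeries (Fin n) κ) :
    Polynomial (MvPowerSeries (Fin n) κ) →+* Polynomial (MvPowerSeries (Fin n) κ) :=
  Polynomial.eval₂RingHom
    (Polynomial.C.comp (substAlgHom (hasSubst_chartSubst (n := n) (K := κ) i τ)).toRingHom)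
    (Polynomial.C (X i) * (Polynomial.X + Polynomial.C r))

/-! ## Coefficient API -/

variable {p : ℕ}

/-- Coefficients of the total-transform series. [folklore] -/
theorem coeff_moveSer (c : (Fin n → ℕ) → κ) (i : Fin n) (τ : Fin n → κ) (A : Fin n →₀ ℕ) :
    coeff A (moveSer p n κ c i τ) = tr n κ i τ p (dv n κ i p (bl n κ i (clean p n κ c))) ⇑A := rfl

/-- Coefficients of the `p`-th-power part. [folklore] -/
theorem coeff_pPowPart (f : MvPowerSeries (Fin n) κ) (A : Fin n →₀ ℕ) :
    coeff A (pPowPart p n κ f) = if ∀ j, p ∣ A j then coeff A f else 0 := rfl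

/-- Coefficients of the `p`-th root. [folklore] -/
theorem coeff_pthRoot [Fact p.Prime] [CharP κ p] [PerfectField κ] (f : MvPowerSeries (Fin n) κ)
    (B : Fin n →₀ ℕ) : coeff B (pthRoot p n κ f) = (frobeniusEquiv κ p).symm (coeff (p • B) f) := rfl

/-! ## The three ingredients -/

/-- [OURS · L1 W4.6] **The crux's dictionary, named**: for a state of multiplicity `p` the chart
substitution of the cleaned series is `u_i^p` times the total-transform series,
`σ_{i,τ}(a) = u_i^p · T` — the sibling crux's `NarrowRunsDie.stub_dict` at `s = p`, in the form landed
as `WildCones.MuDropCharTwoOrdP.X_pow_mul_serT_eq_subst` (its substitution family is `chartSubst`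
definitionally). [folklore] -/
theorem subst_chartSubst_ser (c : (Fin n → ℕ) → κ) (i : Fin n) (τ : Fin n → κ) (hM : MultP p n κ c) :
    MvPowerSeries.subst (chartSubst n κ i τ) (ser p n κ c) = X i ^ p * moveSer p n κ c i τ :=
  (MuDropCharTwoOrdP.X_pow_mul_serT_eq_subst c i τ hM).symm

/-- [OURS · L1 W4.6] **The successor is the cleaning of the total transform**: for a state of
multiplicity `p`, `a′ + (p-th-power part of T) = T` with `a′ = ser (step i τ c)`. [folklore] -/
theorem ser_step_add_pPowPart (c : (Fin n → ℕ) → κ) (i : Fin n) (τ : Fin n → κ) (hM : MultP p n κ c) :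
    ser p n κ (step p n κ i τ c) + pPowPart p n κ (moveSer p n κ c i τ) = moveSer p n κ c i τ := by
  ext A
  rw [map_add, MuDropCharTwoOrdP.coeff_ser_step c i τ hM, coeff_pPowPart, coeff_moveSer]
  unfold clean
  split_ifs with h
  · rw [zero_add]
  · rw [add_zero]

/-- An exponent vector all of whose entries are divisible by `p` is `p` times one. [folklore] -/
theorem exists_eq_smul_of_forall_dvd {A : Fin n →₀ ℕ} (h : ∀ j, p ∣ A j) :
    ∃ B : Fin n →₀ ℕ, A = p • B := by
  refine ⟨Finsupp.equivFunOnFinite.symm (fun j => A j / p), ?_⟩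
  ext j
  rw [Finsupp.smul_apply, Finsupp.coe_equivFunOnFinite_symm, smul_eq_mul,
    Nat.mul_div_cancel' (h j)]

/-- [OURS · L1 W4.6] **`p`-th roots**: over a perfect field of characteristic `p`, the `p`-th power of
`pthRoot f` is the `p`-th-power part of `f` — Frobenius on power series
(`MvPowerSeries.map_frobenius_expand`: `(Σ b_B u^B)^p = Σ b_B^p u^{pB}`). [folklore] -/
theorem pthRoot_pow [Fact p.Prime] [CharP κ p] [PerfectField κ] (f : MvPowerSeries (Fin n) κ) :
    pthRoot p n κ f ^ p = pPowPart p n κ f := by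
  have hp : p ≠ 0 := (Fact.out : p.Prime).ne_zero
  rw [← MvPowerSeries.map_frobenius_expand p hp (f := pthRoot p n κ f)]
  ext A
  rw [coeff_map, coeff_pPowPart]
  by_cases h : ∀ j, p ∣ A j
  · rw [if_pos h]
    obtain ⟨B, rfl⟩ := exists_eq_smul_of_forall_dvd h
    rw [coeff_expand_smul, coeff_pthRoot, ← coe_frobeniusEquiv, RingEquiv.apply_symm_apply]
  · rw [if_neg h]
    obtain ⟨j, hj⟩ := not_forall.mp h
    rw [coeff_expand_of_not_dvd p hp _ hj, map_zero]

/-- [OURS · L1 W4.6] The cleaning shift to the `p` is the `p`-th-power part of the total transform.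
[folklore] -/
theorem cleaningShift_pow [Fact p.Prime] [CharP κ p] [PerfectField κ] (c : (Fin n → ℕ) → κ)
    (i : Fin n) (τ : Fin n → κ) :
    cleaningShift p n κ c i τ ^ p = pPowPart p n κ (moveSer p n κ c i τ) :=
  pthRoot_pow _

/-! ## The blow-up chart map and the main identity -/

/-- `Ψ` acts on `κ⟦u⟧` (constants in `z`) by the chart substitution `σ_{i,τ}`. [folklore] -/
theorem blowupChart_C (i : Fin n) (τ : Fin n → κ) (r f : MvPowerSeries (Fin n) κ) :
    blowupChart n κ i τ r (Polynomial.C f) = Polynomial.C (MvPowerSeries.subst (chartSubst n κ i τ) f) := by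
  unfold blowupChart
  rw [Polynomial.coe_eval₂RingHom, Polynomial.eval₂_C, RingHom.comp_apply]
  simp

/-- `Ψ z = u_i (z + r)`. [folklore] -/
theorem blowupChart_X (i : Fin n) (τ : Fin n → κ) (r : MvPowerSeries (Fin n) κ) :
    blowupChart n κ i τ r Polynomial.X = Polynomial.C (X i) * (Polynomial.X + Polynomial.C r) := by
  unfold blowupChart
  rw [Polynomial.coe_eval₂RingHom, Polynomial.eval₂_X]

/-- `Ψ u_i = u_i` (the exceptional parameter). [folklore] -/
theorem blowupChart_C_X_self (i : Fin n) (τ : Fin n → κ) (r : MvPowerSeries (Fin n) κ) :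
    blowupChart n κ i τ r (Polynomial.C (X i)) = Polynomial.C (X i) := by
  rw [blowupChart_C]
  exact congrArg _ (chartMap_X_self (n := n) (K := κ) i τ)

/-- `Ψ u_j = u_i (u_j + τ_j)` for `j ≠ i`. [folklore] -/
theorem blowupChart_C_X_of_ne (i : Fin n) (τ : Fin n → κ) (r : MvPowerSeries (Fin n) κ) {j : Fin n}
    (hj : j ≠ i) :
    blowupChart n κ i τ r (Polynomial.C (X j)) = Polynomial.C (X i * (X j + C (τ j))) := by
  rw [blowupChart_C]
  exact congrArg _ (chartMap_X_of_ne (n := n) (K := κ) i τ hj)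

/-- [OURS · L1 W4.6 — THE FORMAL DICTIONARY; replaces the role of «the blowup `π : Z′ → Z` with center
`D`» + «the transform `E′` of `E`» (Th. 16.6 p.84 l.5–6, Def. 2.1 p.5) for the forced regime of a
hypersurface `z^p = a(u₁,…,uₙ)`, in formal coordinates; NOT a statement of the manuscript]
**The `WildCones` step is the formal point blow-up of the hypersurface.** For a state `c` of multiplicity
`p` over a perfect field of characteristic `p`, chart `i`, translation `τ`:

  `Ψ (z^p − a) = u_i^p · (z^p − a′)`, `a = ser c`, `a′ = ser (step i τ c)`,

with `Ψ = blowupChart n κ i τ (cleaningShift p n κ c i τ)` the chart-`u_i` blow-up substitution at the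
point `(τ, r(0))` of the exceptional divisor followed by the cleaning change `z ↦ z + (r − r(0))` of the
fibre coordinate: `u_i^p` is the exceptional factor and `z^p − a′` the equation of the transform.
Ingredients: the crux's dictionary `σ_{i,τ}(a) = u_i^p T`, the binomial theorem in characteristic `p`
on `κ⟦u⟧[z]`, and Frobenius on power series (`r^p` = the `p`-th-power part of `T`, `a′ = T − r^p`).
[folklore] -/
theorem blowupChart_atom [Fact p.Prime] [CharP κ p] [PerfectField κ] (c : (Fin n → ℕ) → κ)
    (i : Fin n) (τ : Fin n → κ) (hM : MultP p n κ c) :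
    blowupChart n κ i τ (cleaningShift p n κ c i τ) (Polynomial.X ^ p - Polynomial.C (ser p n κ c)) =
      Polynomial.C (X i ^ p) * (Polynomial.X ^ p - Polynomial.C (ser p n κ (step p n κ i τ c))) := by
  haveI : CharP (MvPowerSeries (Fin n) κ) p :=
    charP_of_injective_ringHom (f := (MvPowerSeries.C : κ →+* MvPowerSeries (Fin n) κ))
      MvPowerSeries.C_injective p
  have hT := ser_step_add_pPowPart c i τ hM
  rw [map_sub, map_pow, blowupChart_X, blowupChart_C, subst_chartSubst_ser c i τ hM, mul_pow,
    add_pow_expChar, ← Polynomial.C_pow, ← Polynomial.C_pow, cleaningShift_pow,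
    show X i ^ p * moveSer p n κ c i τ =
      X i ^ p * (ser p n κ (step p n κ i τ c) + pPowPart p n κ (moveSer p n κ c i τ)) by rw [hT]]
  simp only [map_add, map_mul]
  ring

end CampaignW46.FormalDictionary

end Summit.ResolutionOfSingularities.ResolutionOfSingularities.Theorems

end
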